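import Literature.NumberTheory.GaloisCohomology.Howard2004.SelmerARepresentativeProofs
import Literature.NumberTheory.GaloisRepresentations.SelmerStructureLocalIndexProofs
import HarnessLib

/-!
# The index of `H¹_F(K, A)` in a subgroup of `H¹(K, A) = colim_j H¹(K, T_j)` is bounded LEVEL-WISE, and then
# PLACE-WISE: `#(𝒢 / H¹_F(K, A) ∩ 𝒢) ≤ sup_j #(𝒢_j / H¹_{condA F j} ∩ 𝒢_j) ≤ sup_j ∏_{v ∈ S} [F'_{j,v} : condA F j v]` — proofs file

Topic `NumberTheory/GaloisCohomology/Howard2004` (sequel to `SelmerARepresentativeProofs`, p670633, and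
`GaloisRepresentations/SelmerStructureLocalIndexProofs`, p672270: `AdicTower.H1A / selmerA / condA`,
`SelmerStructure.natCard_quotient_selmerGroup_le_prod_of_local`). THEOREMS ONLY: no definition, no named fact, no
instance, no `sorry`.

WHY (cell `pub/bsd-print-x9`, shared μ-crux `MuInequalityCoherentPairOfPrintCG` stmt-BirchSwinnertonDyer-23428, STUB B, the
registered clause `HeegnerMuPartControlGlue.Stmt.readoutIndex` (B5, p670216); seat `bsd-line-x10b-p1-w2` g11, brick
(B5-GLOB)). After p671042 (`natCard_quotient_eq_of_readout`) the clause is a bound, uniform in `𝔮 = T^m + p`, for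
`#(𝒢 / H¹_F(K, A_𝔮) ∩ 𝒢)` with `𝒢 = readout⁻¹(Sel_∞) ≤ H¹(K, A_𝔮) = colim_j H¹(K, T_j)`. This file reduces it to finitely
many LOCAL indices at ONE level at a time:

* §1 (pure counting) `finite_and_natCard_le_of_forall_finset_card_le`, `finite_and_natCard_le_of_monotone_cover` — a
  type covered by an increasing sequence of finite sets of size `≤ C` is finite of size `≤ C`;
* §2 (abelian groups) **`finite_and_natCard_quotient_le_of_levels`** — for `𝒮, 𝒢 ≤ L`, maps `of j : G j →+ L` with
  increasing ranges covering `𝒢`, and subgroups `Sel j ≤ G j` with `of_j(Sel j) ≤ 𝒮`: if for all `j ≥ j₀` the quotient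
  `of_j⁻¹(𝒢) / (Sel j ∩ of_j⁻¹(𝒢))` is finite of order `≤ C`, then `𝒢 / (𝒮 ∩ 𝒢)` is finite of order `≤ C` (the
  quotient is the increasing union of the images of the level quotients);
* §3 (Howard's `A = colim T/𝔪^{e_j}`) **`AdicTower.finite_and_natCard_quotient_selmerA_le`** — the same for
  `L = H1A`, `𝒮 = selmerA F`, `Sel j = H¹_{condA F j}(K, T_j)` (no hypothesis beyond the definitions);
  **`AdicTower.finite_and_natCard_quotient_selmerA_le_prod`** — composed with the place-wise bound: if the classes of
  level `j ≥ j₀` mapping to `𝒢` satisfy relaxed local conditions `F'_{j,v}` at `v ∈ S` and Howard's `condA F j v` off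
  `S`, and `∏_{v ∈ S} #(F'_{j,v} / condA F j v ∩ F'_{j,v}) ≤ C` (finite), then `𝒢 / (H¹_F(K, A) ∩ 𝒢)` is finite of
  order `≤ C`; `…_le_prod_finite` — the same with `S` a finite set of FINITE places (conditions `condA` at the infinite
  places); `DVRSetting.finite_and_natCard_quotient_selmerA_le_prod_finite` — for a `DVRSetting` with H.0–H.5.

So (B5) = p671042 ∘ this file ∘ [the place-wise arithmetic: the relaxed conditions and the `𝔮`-uniform local indices
at `v ∈ S`, Howard Prop. 2.2.8 / Greenberg LNM 1716 §4].

References: [Howard2004HeegnerKolyvagin] B. Howard, Compositio Math. 140 (2004), §1.6, Thm. 1.6.1, Prop. 2.2.8 and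
proof of Thm. 2.2.10 (arXiv:1202.6340 p. 11 L18–28, p. 17 L41–53); [GreenbergLNM1716] §4 p. 104;
[MazurRubinMemoirs2004] Def. 2.1.1.  BSD is not proved by any of this.
-/

set_option autoImplicit false

noncomputable section

open Function NumberField IsDedekindDomain Field
open scoped NumberField ContRepresentation

namespace Literature.NumberTheory.GaloisCohomology.Howard2004

open Literature.NumberTheory.GaloisRepresentations
open Literature.NumberTheory.GaloisRepresentations.DiscreteGaloisModule
open Literature.NumberTheory.GaloisRepresentations.galoisCohomology

/-! ## §1 Counting: a type covered by an increasing sequence of finite sets of bounded size -/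

/-- A type all of whose finite subsets have at most `C` elements is finite with at most `C` elements.
[cite: Howard2004HeegnerKolyvagin, proof of Thm. 2.2.10 (arXiv p. 17, L41–53)] -/
theorem finite_and_natCard_le_of_forall_finset_card_le {α : Type*} (C : ℕ)
    (h : ∀ t : Finset α, t.card ≤ C) : Finite α ∧ Nat.card α ≤ C := by
  have hfin : Finite α := by
    by_contra hinf
    rw [not_finite_iff_infinite] at hinf
    obtain ⟨t, ht⟩ := Infinite.exists_subset_card_eq α (C + 1)
    have := h t
    omega
  refine ⟨hfin, ?_⟩
  haveI := Fintype.ofFinite α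
  rw [Nat.card_eq_fintype_card, ← Finset.card_univ]
  exact h _

/-- **A type covered by an increasing sequence of sets which, from `j₀` on, are finite of size `≤ C`, is finite of size
`≤ C`** (any finite subset lies in one of the sets). [cite: Howard2004HeegnerKolyvagin, proof of Thm. 2.2.10 (arXiv p. 17, L41–53)] -/
theorem finite_and_natCard_le_of_monotone_cover {α : Type*} (s : ℕ → Set α) (hmono : Monotone s)
    (hcov : ∀ x, ∃ j, x ∈ s j) (j₀ C : ℕ) (hfin : ∀ j, j₀ ≤ j → (s j).Finite)
    (hC : ∀ j, j₀ ≤ j → Nat.card (s j) ≤ C) : Finite α ∧ Nat.card α ≤ C := by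
  classical
  refine finite_and_natCard_le_of_forall_finset_card_le C fun t => ?_
  choose j hj using hcov
  have hJ : ∀ x ∈ t, j x ≤ max j₀ (t.sup j) := fun x hx => (Finset.le_sup hx).trans (le_max_right _ _)
  have hsub : (↑t : Set α) ⊆ s (max j₀ (t.sup j)) := fun x hx => hmono (hJ x hx) (hj x)
  calc t.card = (↑t : Set α).ncard := (Set.ncard_coe_finset t).symm
    _ ≤ (s (max j₀ (t.sup j))).ncard := Set.ncard_le_ncard hsub (hfin _ (le_max_left _ _))
    _ = Nat.card (s (max j₀ (t.sup j))) := (Nat.card_coe_set_eq _).symm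
    _ ≤ C := hC _ (le_max_left _ _)

/-! ## §2 Abelian groups: the index of `𝒮` in `𝒢` from the level-wise indices -/

/-- **Level-wise bound for an index in an increasing union.** `L` an abelian group, `𝒮, 𝒢 ≤ L`; `of j : G j →+ L`
(`j : ℕ`) with increasing ranges covering `𝒢`; `Sel j ≤ G j` with `of_j(Sel j) ≤ 𝒮`. If for every `j ≥ j₀` the
quotient `of_j⁻¹(𝒢) / (Sel j ∩ of_j⁻¹(𝒢))` is finite of order `≤ C`, then `𝒢 / (𝒮 ∩ 𝒢)` is finite of order `≤ C`.
[cite: Howard2004HeegnerKolyvagin, §1.6 and proof of Thm. 2.2.10 (arXiv p. 11 L18–28, p. 17 L41–53)] -/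
theorem finite_and_natCard_quotient_le_of_levels {L : Type*} [AddCommGroup L] (𝒢 𝒮 : AddSubgroup L)
    {G : ℕ → Type*} [∀ j, AddCommGroup (G j)] (of : ∀ j, G j →+ L)
    (hmono : ∀ (j : ℕ) (c : G j), ∃ c' : G (j + 1), of (j + 1) c' = of j c)
    (hcov : ∀ a ∈ 𝒢, ∃ (j : ℕ) (c : G j), of j c = a)
    (Sel : ∀ j, AddSubgroup (G j)) (hSel : ∀ j, (Sel j).map (of j) ≤ 𝒮) (j₀ C : ℕ)
    (hfin : ∀ j, j₀ ≤ j → Finite (↥(𝒢.comap (of j)) ⧸ (Sel j).addSubgroupOf (𝒢.comap (of j))))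
    (hC : ∀ j, j₀ ≤ j → Nat.card (↥(𝒢.comap (of j)) ⧸ (Sel j).addSubgroupOf (𝒢.comap (of j))) ≤ C) :
    Finite (↥𝒢 ⧸ 𝒮.addSubgroupOf 𝒢) ∧ Nat.card (↥𝒢 ⧸ 𝒮.addSubgroupOf 𝒢) ≤ C := by
  -- the projection and the level maps `of_j⁻¹(𝒢) → 𝒢 → 𝒢 / (𝒮 ∩ 𝒢)`
  let π : ↥𝒢 →+ ↥𝒢 ⧸ 𝒮.addSubgroupOf 𝒢 := QuotientAddGroup.mk' (𝒮.addSubgroupOf 𝒢)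
  let ψ : ∀ j, ↥(𝒢.comap (of j)) →+ ↥𝒢 := fun j =>
    ((of j).comp (𝒢.comap (of j)).subtype).codRestrict 𝒢 (fun c => c.2)
  have hψ : ∀ j (c : ↥(𝒢.comap (of j))), (ψ j c : L) = of j c := fun _ _ => rfl
  let φ : ∀ j, ↥(𝒢.comap (of j)) →+ ↥𝒢 ⧸ 𝒮.addSubgroupOf 𝒢 := fun j => π.comp (ψ j)
  have hφ : ∀ j (c : ↥(𝒢.comap (of j))), φ j c = π (ψ j c) := fun _ _ => rfl
  -- the level quotient maps onto the range of `φ j`, which therefore has order `≤ C`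
  have hker : ∀ j, (Sel j).addSubgroupOf (𝒢.comap (of j)) ≤ (φ j).ker := by
    intro j c hc
    rw [AddSubgroup.mem_addSubgroupOf] at hc
    rw [AddMonoidHom.mem_ker, hφ, QuotientAddGroup.mk'_apply, QuotientAddGroup.eq_zero_iff,
      AddSubgroup.mem_addSubgroupOf, hψ]
    exact hSel j ⟨_, hc, rfl⟩
  have hcard : ∀ j, j₀ ≤ j → ((φ j).range : Set (↥𝒢 ⧸ 𝒮.addSubgroupOf 𝒢)).Finite ∧
      Nat.card ((φ j).range : Set (↥𝒢 ⧸ 𝒮.addSubgroupOf 𝒢)) ≤ C := by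
    intro j hj
    have hne : ((Sel j).addSubgroupOf (𝒢.comap (of j))).index ≠ 0 :=
      AddSubgroup.index_ne_zero_iff_finite.mpr (hfin j hj)
    have hdvd : (φ j).ker.index ∣ ((Sel j).addSubgroupOf (𝒢.comap (of j))).index :=
      AddSubgroup.index_dvd_of_le (hker j)
    have hle : Nat.card (φ j).range ≤ C := by
      rw [← AddSubgroup.index_ker]
      exact (Nat.le_of_dvd (Nat.pos_of_ne_zero hne) hdvd).trans (hC j hj)
    have hne' : Nat.card (φ j).range ≠ 0 := by
      rw [← AddSubgroup.index_ker]
      exact fun h0 => hne (Nat.eq_zero_of_zero_dvd (h0 ▸ hdvd))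
    have hfinr : Finite (φ j).range := Nat.finite_of_card_ne_zero hne'
    exact ⟨Set.toFinite _, hle⟩
  -- the ranges increase and cover the quotient
  have hmono' : Monotone fun j => ((φ j).range : Set (↥𝒢 ⧸ 𝒮.addSubgroupOf 𝒢)) := by
    refine monotone_nat_of_le_succ fun j => ?_
    rintro _ ⟨c, rfl⟩
    obtain ⟨c', hc'⟩ := hmono j c
    have hc'𝒢 : c' ∈ 𝒢.comap (of (j + 1)) := by
      rw [AddSubgroup.mem_comap, hc']
      exact c.2
    refine ⟨⟨c', hc'𝒢⟩, ?_⟩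
    change φ (j + 1) ⟨c', hc'𝒢⟩ = φ j c
    rw [hφ, hφ]
    exact congr_arg π (Subtype.ext ((hψ _ _).trans (hc'.trans (hψ _ _).symm)))
  have hcov' : ∀ q : ↥𝒢 ⧸ 𝒮.addSubgroupOf 𝒢, ∃ j, q ∈ ((φ j).range : Set (↥𝒢 ⧸ 𝒮.addSubgroupOf 𝒢)) := by
    intro q
    obtain ⟨a, rfl⟩ := QuotientAddGroup.mk'_surjective (𝒮.addSubgroupOf 𝒢) q
    obtain ⟨j, c, hc⟩ := hcov a a.2
    have hc𝒢 : c ∈ 𝒢.comap (of j) := by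
      rw [AddSubgroup.mem_comap, hc]
      exact a.2
    refine ⟨j, ⟨c, hc𝒢⟩, ?_⟩
    change φ j ⟨c, hc𝒢⟩ = π a
    rw [hφ]
    exact congr_arg π (Subtype.ext ((hψ _ _).trans hc))
  exact finite_and_natCard_le_of_monotone_cover _ hmono' hcov' j₀ C (fun j hj => (hcard j hj).1)
    (fun j hj => (hcard j hj).2)

/-! ## §3 Howard's `H¹(K, A) = colim_j H¹(K, T/𝔪^{e_j} T)` -/

namespace AdicTower

variable {K : Type} [Field K] [NumberField K] {R : Type} [CommRing R] [IsLocalRing R]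
  {N : ℕ → Type} [∀ k, AddCommGroup (N k)] [∀ k, TopologicalSpace (N k)] [∀ k, DiscreteTopology (N k)]
  [∀ k, Module R (N k)]
  (T : AdicTower K R N) (π : R) (e : ℕ → ℕ)
  (hkill : ∀ k, ∀ r ∈ IsLocalRing.maximalIdeal R ^ e k, ∀ x : N k, r • x = 0)
  (hker : ∀ k, LinearMap.ker (T.red k) = (IsLocalRing.maximalIdeal R ^ e k) • (⊤ : Submodule R (N (k + 1))))
  (hπ : π ∈ IsLocalRing.maximalIdeal R) (he : ∀ k, e k ≤ e (k + 1))

/-- **Level-wise bound for `#(𝒢 / H¹_F(K, A) ∩ 𝒢)`.** For any subgroup `𝒢 ≤ H¹(K, A)`: if for every `j ≥ j₀` the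
classes `c ∈ H¹(K, T_j)` with `[c] ∈ 𝒢` modulo the Selmer classes `H¹_{condA F j}(K, T_j)` among them form a finite group
of order `≤ C`, then `𝒢 / (H¹_F(K, A) ∩ 𝒢)` is finite of order `≤ C`. (Only `[H¹_{condA F j}] ≤ H¹_F(K, A)` and
`H¹(K, A) = ⋃_j [H¹(K, T_j)]` are used.) [cite: Howard2004HeegnerKolyvagin, §1.6, Thm. 1.6.1 and proof of Thm. 2.2.10
(arXiv p. 11 L18–28, p. 17 L41–53)] -/
theorem finite_and_natCard_quotient_selmerA_le (F : ∀ k, SelmerStructure (T.ρ k))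
    (𝒢 : AddSubgroup (H1A T π e hkill hker hπ he)) (j₀ C : ℕ)
    (hfin : ∀ j, j₀ ≤ j → Finite (↥(𝒢.comap (AddCommGroup.DirectLimit.of (fun k => galoisCohomology (T.ρ k) 1)
        (incH1LE T π e hkill hker hπ he) j)) ⧸ ((condA T π e hkill hker hπ he F j).selmerGroup).addSubgroupOf
        (𝒢.comap (AddCommGroup.DirectLimit.of (fun k => galoisCohomology (T.ρ k) 1)
          (incH1LE T π e hkill hker hπ he) j))))
    (hC : ∀ j, j₀ ≤ j → Nat.card (↥(𝒢.comap (AddCommGroup.DirectLimit.of (fun k => galoisCohomology (T.ρ k) 1)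
        (incH1LE T π e hkill hker hπ he) j)) ⧸ ((condA T π e hkill hker hπ he F j).selmerGroup).addSubgroupOf
        (𝒢.comap (AddCommGroup.DirectLimit.of (fun k => galoisCohomology (T.ρ k) 1)
          (incH1LE T π e hkill hker hπ he) j))) ≤ C) :
    Finite (↥𝒢 ⧸ (selmerA T π e hkill hker hπ he F).addSubgroupOf 𝒢) ∧
      Nat.card (↥𝒢 ⧸ (selmerA T π e hkill hker hπ he F).addSubgroupOf 𝒢) ≤ C := by
  refine finite_and_natCard_quotient_le_of_levels 𝒢 (selmerA T π e hkill hker hπ he F)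
    (fun j => AddCommGroup.DirectLimit.of (fun k => galoisCohomology (T.ρ k) 1) (incH1LE T π e hkill hker hπ he) j)
    (fun j c => ⟨incH1LE T π e hkill hker hπ he j (j + 1) (Nat.le_succ j) c,
      AddCommGroup.DirectLimit.of_f (G := fun k => galoisCohomology (T.ρ k) 1)
        (f := incH1LE T π e hkill hker hπ he) (Nat.le_succ j) c⟩)
    (fun a _ => ?_) (fun j => (condA T π e hkill hker hπ he F j).selmerGroup) (fun j => ?_) j₀ C hfin hC
  · induction a using AddCommGroup.DirectLimit.induction_on with
    | ih i x => exact ⟨i, x, rfl⟩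
  · unfold selmerA
    exact le_iSup (fun j => ((condA T π e hkill hker hπ he F j).selmerGroup).map
      (AddCommGroup.DirectLimit.of (fun k => galoisCohomology (T.ρ k) 1) (incH1LE T π e hkill hker hπ he) j)) j

/-- **Level-wise AND place-wise bound for `#(𝒢 / H¹_F(K, A) ∩ 𝒢)`** (the shape of Howard's Prop. 2.2.8, second map,
as an upper bound). For `𝒢 ≤ H¹(K, A)`, a finite set `S` of places, relaxed local conditions `F'_j` (`j ≥ j₀`): if every
class `c ∈ H¹(K, T_j)` with `[c] ∈ 𝒢` has `loc_v c ∈ F'_{j,v}` for `v ∈ S` and `loc_v c ∈ condA F j v` for `v ∉ S`, and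
the local quotients `F'_{j,v} / (condA F j v ∩ F'_{j,v})`, `v ∈ S`, are finite with `∏_{v ∈ S} # ≤ C`, then
`𝒢 / (H¹_F(K, A) ∩ 𝒢)` is finite of order `≤ C`. [cite: Howard2004HeegnerKolyvagin, Prop. 2.2.8 and proof of Thm. 2.2.10
(arXiv p. 17, L41–53)] [cite: GreenbergLNM1716, §4 p. 104] -/
theorem finite_and_natCard_quotient_selmerA_le_prod (F : ∀ k, SelmerStructure (T.ρ k))
    (𝒢 : AddSubgroup (H1A T π e hkill hker hπ he)) (S : Finset (Place K)) (F' : ∀ j, SelmerStructure (T.ρ j))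
    (j₀ C : ℕ)
    (hS : ∀ j, j₀ ≤ j → ∀ c : galoisCohomology (T.ρ j) 1,
      AddCommGroup.DirectLimit.of (fun k => galoisCohomology (T.ρ k) 1) (incH1LE T π e hkill hker hπ he) j c ∈ 𝒢 →
        ∀ v ∈ S, galoisCohomology.localization (T.ρ j) v 1 c ∈ F' j v)
    (hoff : ∀ j, j₀ ≤ j → ∀ c : galoisCohomology (T.ρ j) 1,
      AddCommGroup.DirectLimit.of (fun k => galoisCohomology (T.ρ k) 1) (incH1LE T π e hkill hker hπ he) j c ∈ 𝒢 →
        ∀ v ∉ S, galoisCohomology.localization (T.ρ j) v 1 c ∈ condA T π e hkill hker hπ he F j v)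
    (hfin : ∀ j, j₀ ≤ j → ∀ v ∈ S, Finite (↥(F' j v) ⧸ (condA T π e hkill hker hπ he F j v).addSubgroupOf (F' j v)))
    (hC : ∀ j, j₀ ≤ j →
      ∏ v ∈ S, Nat.card (↥(F' j v) ⧸ (condA T π e hkill hker hπ he F j v).addSubgroupOf (F' j v)) ≤ C) :
    Finite (↥𝒢 ⧸ (selmerA T π e hkill hker hπ he F).addSubgroupOf 𝒢) ∧
      Nat.card (↥𝒢 ⧸ (selmerA T π e hkill hker hπ he F).addSubgroupOf 𝒢) ≤ C := by
  refine finite_and_natCard_quotient_selmerA_le T π e hkill hker hπ he F 𝒢 j₀ C (fun j hj => ?_) (fun j hj => ?_)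
  · exact SelmerStructure.finite_quotient_selmerGroup_of_local (condA T π e hkill hker hπ he F j) (F' j) S _
      (fun c hc v hv => hS j hj c hc v hv) (fun c hc v hv => hoff j hj c hc v hv) (hfin j hj)
  · exact (SelmerStructure.natCard_quotient_selmerGroup_le_prod_of_local (condA T π e hkill hker hπ he F j) (F' j)
      S _ (fun c hc v hv => hS j hj c hc v hv) (fun c hc v hv => hoff j hj c hc v hv) (hfin j hj)).trans (hC j hj)

/-- The same with `S` a finite set of FINITE places: conditions `condA F j` at every infinite place and every finite
place outside `S`, relaxed conditions `F'_{j,v}` at `v ∈ S`. [cite: Howard2004HeegnerKolyvagin, Prop. 2.2.8 and proof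
of Thm. 2.2.10 (arXiv p. 17, L41–53)] [cite: GreenbergLNM1716, §4 p. 104] -/
theorem finite_and_natCard_quotient_selmerA_le_prod_finite (F : ∀ k, SelmerStructure (T.ρ k))
    (𝒢 : AddSubgroup (H1A T π e hkill hker hπ he)) (S : Finset (HeightOneSpectrum (𝓞 K)))
    (F' : ∀ j, SelmerStructure (T.ρ j)) (j₀ C : ℕ)
    (hS : ∀ j, j₀ ≤ j → ∀ c : galoisCohomology (T.ρ j) 1,
      AddCommGroup.DirectLimit.of (fun k => galoisCohomology (T.ρ k) 1) (incH1LE T π e hkill hker hπ he) j c ∈ 𝒢 →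
        ∀ v ∈ S, galoisCohomology.localization (T.ρ j) (Sum.inr v) 1 c ∈ F' j (Sum.inr v))
    (hoff : ∀ j, j₀ ≤ j → ∀ c : galoisCohomology (T.ρ j) 1,
      AddCommGroup.DirectLimit.of (fun k => galoisCohomology (T.ρ k) 1) (incH1LE T π e hkill hker hπ he) j c ∈ 𝒢 →
        ∀ v ∉ S, galoisCohomology.localization (T.ρ j) (Sum.inr v) 1 c ∈
          condA T π e hkill hker hπ he F j (Sum.inr v))
    (hinf : ∀ j, j₀ ≤ j → ∀ c : galoisCohomology (T.ρ j) 1,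
      AddCommGroup.DirectLimit.of (fun k => galoisCohomology (T.ρ k) 1) (incH1LE T π e hkill hker hπ he) j c ∈ 𝒢 →
        ∀ w : InfinitePlace K, galoisCohomology.localization (T.ρ j) (Sum.inl w) 1 c ∈
          condA T π e hkill hker hπ he F j (Sum.inl w))
    (hfin : ∀ j, j₀ ≤ j → ∀ v ∈ S, Finite (↥(F' j (Sum.inr v)) ⧸
      (condA T π e hkill hker hπ he F j (Sum.inr v)).addSubgroupOf (F' j (Sum.inr v))))
    (hC : ∀ j, j₀ ≤ j → ∏ v ∈ S, Nat.card (↥(F' j (Sum.inr v)) ⧸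
      (condA T π e hkill hker hπ he F j (Sum.inr v)).addSubgroupOf (F' j (Sum.inr v))) ≤ C) :
    Finite (↥𝒢 ⧸ (selmerA T π e hkill hker hπ he F).addSubgroupOf 𝒢) ∧
      Nat.card (↥𝒢 ⧸ (selmerA T π e hkill hker hπ he F).addSubgroupOf 𝒢) ≤ C := by
  classical
  refine finite_and_natCard_quotient_selmerA_le_prod T π e hkill hker hπ he F 𝒢
    (S.map ⟨Sum.inr, Sum.inr_injective⟩) F' j₀ C (fun j hj c hc v hv => ?_) (fun j hj c hc v hv => ?_)
    (fun j hj v hv => ?_) (fun j hj => ?_)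
  · obtain ⟨v', hv', rfl⟩ := Finset.mem_map.mp hv
    exact hS j hj c hc v' hv'
  · rcases v with w | v'
    · exact hinf j hj c hc w
    · exact hoff j hj c hc v' fun h => hv (Finset.mem_map.mpr ⟨v', h, rfl⟩)
  · obtain ⟨v', hv', rfl⟩ := Finset.mem_map.mp hv
    exact hfin j hj v' hv'
  · rw [Finset.prod_map]
    exact hC j hj

end AdicTower

/-! ## §4 For a `DVRSetting` with H.0–H.5 -/

namespace DVRSetting

variable {p : ℕ} [Fact p.Prime] {K : Type} [Field K] [NumberField K]
  {R : Type} [CommRing R] [IsDomain R] [IsDiscreteValuationRing R] [Algebra ℤ_[p] R]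
  {N : ℕ → Type} [∀ k, AddCommGroup (N k)] [∀ k, TopologicalSpace (N k)] [∀ k, DiscreteTopology (N k)]
  [∀ k, Module R (N k)]
  {Rk : ℕ → Type} [∀ k, CommRing (Rk k)] [∀ k, IsLocalRing (Rk k)] [∀ k, TopologicalSpace (Rk k)]
  [∀ k, DiscreteTopology (Rk k)] [∀ k, Algebra ℤ_[p] (Rk k)] [∀ k, Algebra R (Rk k)]
  [∀ k, Module (Rk k) (N k)] [∀ k, IsScalarTower R (Rk k) (N k)]
  {Nbar : Type} [AddCommGroup Nbar] [TopologicalSpace Nbar] [DiscreteTopology Nbar] [∀ k, Module (Rk k) Nbar]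
  {Nq : ℕ → Finset (HeightOneSpectrum (𝓞 K)) → Type} [∀ k n, AddCommGroup (Nq k n)]
  [∀ k n, TopologicalSpace (Nq k n)] [∀ k n, DiscreteTopology (Nq k n)] [∀ k n, Module (Rk k) (Nq k n)]
  [∀ k n, Module R (Nq k n)] [∀ k n, IsScalarTower R (Rk k) (Nq k n)]
  (St : DVRSetting p K R N Rk Nbar Nq) (hy : St.SatisfiesH)

/-- **Level-wise and place-wise bound for `#(𝒢 / H¹_F(K, A) ∩ 𝒢)` for a `DVRSetting` with H.0–H.5** (`F = (St.t ·).cond`,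
any proofs `hπ`, `he`): `S` a finite set of finite places, relaxed conditions `F'_{j,v}` at `v ∈ S` satisfied by the
classes mapping to `𝒢`, Howard's `condA` conditions elsewhere, local quotients at `v ∈ S` finite with product `≤ C`
for all `j ≥ j₀` ⟹ `𝒢 / (H¹_F(K, A) ∩ 𝒢)` finite of order `≤ C`. [cite: Howard2004HeegnerKolyvagin, Prop. 2.2.8 and proof
of Thm. 2.2.10 (arXiv p. 17, L41–53)] [cite: GreenbergLNM1716, §4 p. 104] -/
theorem finite_and_natCard_quotient_selmerA_le_prod_finite (hπ : St.π ∈ IsLocalRing.maximalIdeal R)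
    (he : ∀ k, St.e k ≤ St.e (k + 1))
    (𝒢 : AddSubgroup (AdicTower.H1A St.T St.π St.e hy.killed hy.ker_red hπ he))
    (S : Finset (HeightOneSpectrum (𝓞 K))) (F' : ∀ j, SelmerStructure (St.T.ρ j)) (j₀ C : ℕ)
    (hS : ∀ j, j₀ ≤ j → ∀ c : galoisCohomology (St.T.ρ j) 1,
      AddCommGroup.DirectLimit.of (fun k => galoisCohomology (St.T.ρ k) 1)
        (AdicTower.incH1LE St.T St.π St.e hy.killed hy.ker_red hπ he) j c ∈ 𝒢 →
        ∀ v ∈ S, galoisCohomology.localization (St.T.ρ j) (Sum.inr v) 1 c ∈ F' j (Sum.inr v))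
    (hoff : ∀ j, j₀ ≤ j → ∀ c : galoisCohomology (St.T.ρ j) 1,
      AddCommGroup.DirectLimit.of (fun k => galoisCohomology (St.T.ρ k) 1)
        (AdicTower.incH1LE St.T St.π St.e hy.killed hy.ker_red hπ he) j c ∈ 𝒢 →
        ∀ v ∉ S, galoisCohomology.localization (St.T.ρ j) (Sum.inr v) 1 c ∈
          AdicTower.condA St.T St.π St.e hy.killed hy.ker_red hπ he (fun k => (St.t k).cond) j (Sum.inr v))
    (hinf : ∀ j, j₀ ≤ j → ∀ c : galoisCohomology (St.T.ρ j) 1,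
      AddCommGroup.DirectLimit.of (fun k => galoisCohomology (St.T.ρ k) 1)
        (AdicTower.incH1LE St.T St.π St.e hy.killed hy.ker_red hπ he) j c ∈ 𝒢 →
        ∀ w : InfinitePlace K, galoisCohomology.localization (St.T.ρ j) (Sum.inl w) 1 c ∈
          AdicTower.condA St.T St.π St.e hy.killed hy.ker_red hπ he (fun k => (St.t k).cond) j (Sum.inl w))
    (hfin : ∀ j, j₀ ≤ j → ∀ v ∈ S, Finite (↥(F' j (Sum.inr v)) ⧸
      (AdicTower.condA St.T St.π St.e hy.killed hy.ker_red hπ he (fun k => (St.t k).cond) j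
        (Sum.inr v)).addSubgroupOf (F' j (Sum.inr v))))
    (hC : ∀ j, j₀ ≤ j → ∏ v ∈ S, Nat.card (↥(F' j (Sum.inr v)) ⧸
      (AdicTower.condA St.T St.π St.e hy.killed hy.ker_red hπ he (fun k => (St.t k).cond) j
        (Sum.inr v)).addSubgroupOf (F' j (Sum.inr v))) ≤ C) :
    Finite (↥𝒢 ⧸ (St.T.selmerA St.π St.e hy.killed hy.ker_red hπ he (fun k => (St.t k).cond)).addSubgroupOf 𝒢) ∧
      Nat.card (↥𝒢 ⧸ (St.T.selmerA St.π St.e hy.killed hy.ker_red hπ he (fun k => (St.t k).cond)).addSubgroupOf 𝒢)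
        ≤ C :=
  AdicTower.finite_and_natCard_quotient_selmerA_le_prod_finite St.T St.π St.e hy.killed hy.ker_red hπ he
    (fun k => (St.t k).cond) 𝒢 S F' j₀ C hS hoff hinf hfin hC

end DVRSetting

end Literature.NumberTheory.GaloisCohomology.Howard2004

end
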